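import Mathlib.Analysis.Complex.ExponentialBounds
import Mathlib.NumberTheory.Primorial
import Mathlib.Data.Nat.Log
import Literature.Barriers.MatrixMultiplication.TricoloredSumFreeBarrier
import Literature.Computability.AlgebraicComplexity.GroupTheoreticMatMulThmBProofs
import HarnessLib

/-!
# Proof of the tricolored sum-free barrier (Blasiak–Church–Cohn–Grochow–Naslund–Sawin–Umans 2017, Thms. A, A′, 4.14, B)

Topic `Literature/Barriers/MatrixMultiplication`; sibling proof file of
`TricoloredSumFreeBarrier.lean`, discharging its catalogue entry
`Literature.Barriers.MatrixMultiplication.TricoloredSumFreeBarrier = BCCGNSU2017_thmA ∧ BCCGNSU2017_thmA' ∧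
BCCGNSU2017_thm414 ∧ BlasiakChurchCohnGrochowNaslundSawinUmans2017_B` as the sorry-free theorem
`TricoloredSumFreeBarrier_holds`. The fourth conjunct (Thm. B) is the tree's
`Literature.Computability.AlgebraicComplexity.BlasiakChurchCohnGrochowNaslundSawinUmans2017_B_holds`
(`GroupTheoreticMatMulThmBProofs.lean`); the three explicit-constant statements are proved here:

* `BCCGNSU2017_thm414_holds` — **Thm. 4.14** (`|M| ≤ 3|H| J(q)ⁿ` for `H ≅ (ℤ/q)ⁿ × G`): the
  tree's counting form `IsTricoloredSumFree.card_le_of_addEquiv` (`|M| ≤ 3 · #LowWeight · |G|`,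
  Props. 4.8, 4.2, 4.13, 4.15) plus the sharp large-deviation count
  `card_lowWeight_le_pow : #LowWeight ≤ (q J(q))ⁿ` (Prop. 4.12 at `α = 1/3`: the tree's
  generating-function bound `card_lowWeight_mul_pow_le` at `v = x^{1/3}` for every `x ∈ (0,1)`,
  then the infimum defining `J`, eq. (4.10)).
* `BCCGNSU2017_thmA'_holds` — **Thm. A′** (`|M| ≤ 3|H|^{1-δ/log q}` for `H ≅ (ℤ/q)ⁿ`): Thm. 4.14
  with trivial `G` and `J(q) ≤ e^{-δ} = (3/4)2^{1/3}` (`bccgnsuJ_le_exp_neg_delta`).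
* `BCCGNSU2017_thmA_holds` — **Thm. A** (`|M| ≤ 3|H|^{1-ε/m}`, `ε = δ/2`, `H` generated by
  elements of order `≤ m`): see its docstring.

## Deviations from the printed proofs (same statements, different bookkeeping)

* "`J(s)` is decreasing" (stated after (4.10), from Prop. 4.12 by calculus) is replaced by two
  explicit evaluations of the infimum (4.10): `J(s) ≤ (3/4)2^{1/3} = J(2) = e^{-δ}` for all
  `s ≥ 2` (`bccgnsuJ_le_J_two`, at `x = (3m-1)/(3m+1)`, `m = s-1`, exact) and
  `J(s) ≤ 25/28 < e^{-2δ}` for `s ≥ 7` (`bccgnsuJ_le_of_seven_le`, at `x = (25m-31)/(25m+18)`),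
  the needed lower bounds `x^m ≥ 1/2`, `x^m ≥ 1/8` coming from Bonferroni's inequalities
  `(1-a)^m ≥ Σ_{k ≤ K} (-1)^k C(m,k) a^k` (`K = 3, 7`, proved by induction on `m`).
* The prime-number-theorem input of the proof of Thm. A ("the number `r` of prime powers `≤ m`
  is `< 2m/log m`", via Rosser–Schoenfeld) is replaced by the Chebyshev-type product bound
  `prod_primePow_le_pow : 120 · Π_{v ∈ S} v ≤ 54^m` for any set `S` of distinct prime powers
  `≤ m` (Mathlib's `primorial_le_four_pow` for the primes, a crude count of the proper prime
  powers, and an elementary growth inequality over dyadic ranges), which suffices once the prime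
  powers `v ≥ 7` are given the weight `2` allowed by `J(v) ≤ e^{-2δ}`: choosing the factor
  `(ℤ/v₀)^{n_{v₀}}` of `H` maximising `w_v ∈ {n_v, 2n_v}` gives `J(v₀)^{n_{v₀}} ≤ e^{-δ μ}` with
  `|H|² ≤ 54^{m μ} < e^{4 m μ}`, i.e. `μ ≥ log|H|/(2m)`, exactly the exponent `1 - δ/(2m)` printed.
* "`H` generated by elements of order `≤ m` ⟹ `H ≅ Π (ℤ/qᵢ)^{nᵢ}` over prime powers `qᵢ ≤ m`"
  is `factor_le_of_closure_eq_top` (structure theorem `AddCommGroup.equiv_directSum_zmod_of_finite`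
  + projection onto a factor).

## References

* J. Blasiak, T. Church, H. Cohn, J. A. Grochow, E. Naslund, W. F. Sawin, C. Umans, *On cap sets
  and the group-theoretic approach to matrix multiplication*, Discrete Analysis 2017:3,
  arXiv:1605.06702: Thm. A, Thm. A′ (p. 3), eq. (4.10)–(4.11), Prop. 4.12, Prop. 4.13 (p. 15),
  Thm. 4.14, Prop. 4.15 and the proofs of Thms. 4.14, A′, A (p. 16). (Page numbers of the held
  19-page extraction, `lit read arxiv:1605.06702 --pages …`.)
-/

noncomputable section

open scoped BigOperators
open Finset

namespace Literature.Barriers.MatrixMultiplication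

/-! ## Bonferroni-type lower bounds for `(1 - a)^m` -/

section Bonferroni

/-- **Bonferroni inequality (cubic)**: `(1-a)^m ≥ 1 - m a + C(m,2)a² - C(m,3)a³` for `a ≤ 1`
(binomial coefficients written as polynomials in `m`), by induction on `m`:
`(1-a)·S₃(m) = S₃(m+1) + C(m,3) a⁴`. [folklore] -/
theorem bonferroni_cubic_le_pow (a : ℝ) (ha1 : a ≤ 1) (m : ℕ) :
    1 - m * a + m * (m - 1) / 2 * a ^ 2 - m * (m - 1) * (m - 2) / 6 * a ^ 3 ≤ (1 - a) ^ m := by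
  induction m with
  | zero => simp
  | succ n ih =>
    have h1 : 0 ≤ 1 - a := by linarith
    have step : (1 - a) * (1 - n * a + n * (n - 1) / 2 * a ^ 2 - n * (n - 1) * (n - 2) / 6 * a ^ 3)
        ≤ (1 - a) ^ (n + 1) := by
      rw [pow_succ' (1 - a) n]; exact mul_le_mul_of_nonneg_left ih h1
    have hR : 0 ≤ (n : ℝ) * (n - 1) * (n - 2) / 6 * a ^ 4 := by
      have hp : 0 ≤ (n : ℝ) * (n - 1) * (n - 2) := by
        rcases Nat.lt_or_ge n 2 with hn | hn
        · interval_cases n <;> norm_num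
        · have h2 : (2 : ℝ) ≤ n := by exact_mod_cast hn
          exact mul_nonneg (mul_nonneg (by linarith) (by linarith)) (by linarith)
      positivity
    push_cast
    linarith

/-- **Bonferroni inequality (degree 7)**: `(1-a)^m ≥ Σ_{k ≤ 7} (-1)^k C(m,k) a^k` for `a ≤ 1`,
by induction on `m`: `(1-a)·S₇(m) = S₇(m+1) + C(m,7) a⁸`. [folklore] -/
theorem bonferroni_septic_le_pow (a : ℝ) (ha1 : a ≤ 1) (m : ℕ) :
    1 - m * a + m * (m - 1) / 2 * a ^ 2 - m * (m - 1) * (m - 2) / 6 * a ^ 3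
      + m * (m - 1) * (m - 2) * (m - 3) / 24 * a ^ 4
      - m * (m - 1) * (m - 2) * (m - 3) * (m - 4) / 120 * a ^ 5
      + m * (m - 1) * (m - 2) * (m - 3) * (m - 4) * (m - 5) / 720 * a ^ 6
      - m * (m - 1) * (m - 2) * (m - 3) * (m - 4) * (m - 5) * (m - 6) / 5040 * a ^ 7
      ≤ (1 - a) ^ m := by
  induction m with
  | zero => simp
  | succ n ih =>
    have h1 : 0 ≤ 1 - a := by linarith
    have step : (1 - a) *
        (1 - n * a + n * (n - 1) / 2 * a ^ 2 - n * (n - 1) * (n - 2) / 6 * a ^ 3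
          + n * (n - 1) * (n - 2) * (n - 3) / 24 * a ^ 4
          - n * (n - 1) * (n - 2) * (n - 3) * (n - 4) / 120 * a ^ 5
          + n * (n - 1) * (n - 2) * (n - 3) * (n - 4) * (n - 5) / 720 * a ^ 6
          - n * (n - 1) * (n - 2) * (n - 3) * (n - 4) * (n - 5) * (n - 6) / 5040 * a ^ 7)
        ≤ (1 - a) ^ (n + 1) := by
      rw [pow_succ' (1 - a) n]; exact mul_le_mul_of_nonneg_left ih h1
    have hR : 0 ≤ (n : ℝ) * (n - 1) * (n - 2) * (n - 3) * (n - 4) * (n - 5) * (n - 6) / 5040 *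
        a ^ 8 := by
      have hp : 0 ≤ (n : ℝ) * (n - 1) * (n - 2) * (n - 3) * (n - 4) * (n - 5) * (n - 6) := by
        rcases Nat.lt_or_ge n 6 with hn | hn
        · interval_cases n <;> norm_num
        · have h6 : (6 : ℝ) ≤ n := by exact_mod_cast hn
          refine mul_nonneg (mul_nonneg (mul_nonneg (mul_nonneg (mul_nonneg (mul_nonneg ?_ ?_)
            ?_) ?_) ?_) ?_) ?_ <;> linarith
      positivity
    push_cast
    linarith

/-- `((3m-1)/(3m+1))^m ≥ 1/2` for `m ≥ 1` (cubic Bonferroni; the defect is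
`(m-1)(m²+10m-3)/(6(3m+1)³)`). [folklore] -/
theorem half_le_one_sub_div_pow (m : ℕ) (hm : 1 ≤ m) :
    (1 / 2 : ℝ) ≤ (1 - 2 / (3 * m + 1)) ^ m := by
  obtain ⟨t, rfl⟩ : ∃ t, m = t + 1 := ⟨m - 1, by omega⟩
  have ht : (0 : ℝ) ≤ t := Nat.cast_nonneg t
  have hden : (0 : ℝ) < 3 * ((t + 1 : ℕ) : ℝ) + 1 := by positivity
  have hB := bonferroni_cubic_le_pow (2 / (3 * ((t + 1 : ℕ) : ℝ) + 1))
    (by rw [div_le_one hden]; push_cast; linarith) (t + 1)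
  refine le_trans ?_ hB
  have key : (1 : ℝ) - ((t + 1 : ℕ) : ℝ) * (2 / (3 * ((t + 1 : ℕ) : ℝ) + 1))
      + ((t + 1 : ℕ) : ℝ) * (((t + 1 : ℕ) : ℝ) - 1) / 2 * (2 / (3 * ((t + 1 : ℕ) : ℝ) + 1)) ^ 2
      - ((t + 1 : ℕ) : ℝ) * (((t + 1 : ℕ) : ℝ) - 1) * (((t + 1 : ℕ) : ℝ) - 2) / 6 *
        (2 / (3 * ((t + 1 : ℕ) : ℝ) + 1)) ^ 3 =
      1 / 2 + t * (t ^ 2 + 12 * t + 8) / (6 * (3 * ((t + 1 : ℕ) : ℝ) + 1) ^ 3) := by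
    push_cast
    field_simp
    ring
  rw [key]
  have : 0 ≤ t * (t ^ 2 + 12 * t + 8) / (6 * (3 * ((t + 1 : ℕ) : ℝ) + 1) ^ 3) := by positivity
  linarith

/-- `((25m-31)/(25m+18))^m ≥ 1/8` for `m ≥ 6` (degree-7 Bonferroni; the defect, as a polynomial
in `t = m - 6`, has nonnegative coefficients). [folklore] -/
theorem eighth_le_one_sub_div_pow (m : ℕ) (hm : 6 ≤ m) :
    (1 / 8 : ℝ) ≤ (1 - 49 / (25 * m + 18)) ^ m := by
  obtain ⟨t, rfl⟩ : ∃ t, m = t + 6 := ⟨m - 6, by omega⟩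
  have ht : (0 : ℝ) ≤ t := Nat.cast_nonneg t
  have hden : (0 : ℝ) < 25 * ((t + 6 : ℕ) : ℝ) + 18 := by positivity
  have hB := bonferroni_septic_le_pow (49 / (25 * ((t + 6 : ℕ) : ℝ) + 18))
    (by rw [div_le_one hden]; push_cast; linarith) (t + 6)
  refine le_trans ?_ hB
  set M : ℝ := ((t + 6 : ℕ) : ℝ) with hM
  set A : ℝ := 49 / (25 * ((t + 6 : ℕ) : ℝ) + 18) with hA
  have hMt : M = t + 6 := by rw [hM]; push_cast; ring
  have key : 1 - M * A + M * (M - 1) / 2 * A ^ 2 - M * (M - 1) * (M - 2) / 6 * A ^ 3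
      + M * (M - 1) * (M - 2) * (M - 3) / 24 * A ^ 4
      - M * (M - 1) * (M - 2) * (M - 3) * (M - 4) / 120 * A ^ 5
      + M * (M - 1) * (M - 2) * (M - 3) * (M - 4) * (M - 5) / 720 * A ^ 6
      - M * (M - 1) * (M - 2) * (M - 3) * (M - 4) * (M - 5) * (M - 6) / 5040 * A ^ 7 =
      1 / 8 + (198990053954657280 + 646137871775682048 * t + 464332717958257344 * t ^ 2 +
          154366108952654592 * t ^ 3 + 28102612252846320 * t ^ 4 + 2869715647322832 * t ^ 5 +
          149752230580176 * t ^ 6 + 2814772708608 * t ^ 7) /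
          (40320 * (25 * M + 18) ^ 7) := by
    rw [hA, ← hM, hMt]
    have hden' : (0 : ℝ) < 25 * (t + 6) + 18 := by positivity
    field_simp
    ring
  rw [key]
  have : 0 ≤ (198990053954657280 + 646137871775682048 * t + 464332717958257344 * t ^ 2 +
      154366108952654592 * t ^ 3 + 28102612252846320 * t ^ 4 + 2869715647322832 * t ^ 5 +
      149752230580176 * t ^ 6 + 2814772708608 * t ^ 7) / (40320 * (25 * M + 18) ^ 7) := by
    rw [hMt]; positivity
  linarith

end Bonferroni

/-! ## Explicit bounds for the rate function `J` -/

section JBounds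

/-- **`J(s) ≤ (3/4)·2^{1/3} = J(2) = e^{-δ}` for every `s ≥ 2`** (BCCGNSU 2017 state "`J(s)` is
decreasing" after (4.10), via Prop. 4.12; here a direct proof): evaluate the infimum defining
`J(s)` at `x = (3m-1)/(3m+1)`, `m = s - 1`, where `x^m ≥ 1/2` (cubic Bonferroni), so that
`x^{-m/3} ≤ 2^{1/3}` and `(1 - x^s)/(s(1-x)) ≤ (1 - x/2)/(s(1-x)) = 3/4`.
[cite: BlasiakChurchCohnGrochowNaslundSawinUmans2017, (4.10)–(4.11)] -/
theorem bccgnsuJ_le_J_two {s : ℕ} (hs : 2 ≤ s) :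
    bccgnsuJ s ≤ 3 / 4 * (2 : ℝ) ^ (1 / 3 : ℝ) := by
  obtain ⟨m, rfl⟩ : ∃ m, s = m + 1 := ⟨s - 1, by omega⟩
  have hm1 : 1 ≤ m := by omega
  have hmR : (1 : ℝ) ≤ m := by exact_mod_cast hm1
  set x : ℝ := 1 - 2 / (3 * m + 1) with hx
  have hden : (0 : ℝ) < 3 * m + 1 := by positivity
  have hx0 : 0 < x := by
    rw [hx, sub_pos, div_lt_one hden]; linarith
  have hx1 : x < 1 := by
    rw [hx, sub_lt_self_iff]; positivity
  have h1x : 0 < 1 - x := by linarith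
  have hxm : (1 / 2 : ℝ) ≤ x ^ m := half_le_one_sub_div_pow m hm1
  have hJ := bccgnsuJ_le (s := m + 1) hx0 hx1
  have hcast : (((m + 1 : ℕ) : ℝ) - 1) = (m : ℝ) := by push_cast; ring
  rw [hcast] at hJ
  -- the geometric sum
  have hgeom : (∑ i ∈ Finset.range (m + 1), x ^ i) = (1 - x ^ (m + 1)) / (1 - x) := by
    rw [eq_div_iff h1x.ne', geom_sum_mul_neg]
  -- the power `x^{-m/3} ≤ 2^{1/3}`
  have hpow : x ^ (-((m : ℝ) / 3)) ≤ (2 : ℝ) ^ (1 / 3 : ℝ) := by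
    have h1 : x ^ (-((m : ℝ) / 3)) = (x ^ m) ^ (-(1 / 3 : ℝ)) := by
      rw [← Real.rpow_natCast_mul hx0.le]; congr 1; ring
    have h2 : (x ^ m) ^ (-(1 / 3 : ℝ)) ≤ (1 / 2 : ℝ) ^ (-(1 / 3 : ℝ)) :=
      Real.rpow_le_rpow_of_nonpos (by norm_num) hxm (by norm_num)
    have h3 : (1 / 2 : ℝ) ^ (-(1 / 3 : ℝ)) = (2 : ℝ) ^ (1 / 3 : ℝ) := by
      rw [Real.rpow_neg (by norm_num), one_div (2 : ℝ), Real.inv_rpow (by norm_num), inv_inv]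
    rw [h1, ← h3]; exact h2
  -- the geometric factor
  have hsum : (1 - x ^ (m + 1)) / (1 - x) ≤ (1 - x / 2) / (1 - x) := by
    refine div_le_div_of_nonneg_right ?_ h1x.le
    have : x / 2 ≤ x ^ (m + 1) := by
      rw [pow_succ']
      have := mul_le_mul_of_nonneg_left hxm hx0.le
      linarith
    linarith
  have hratio : (1 - x / 2) / (1 - x) / ((m + 1 : ℕ) : ℝ) = 3 / 4 := by
    rw [hx]; field_simp; push_cast; ring
  calc bccgnsuJ (m + 1)
      ≤ (∑ i ∈ Finset.range (m + 1), x ^ i) * x ^ (-((m : ℝ) / 3)) / ((m + 1 : ℕ) : ℝ) := hJ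
    _ ≤ (1 - x / 2) / (1 - x) * (2 : ℝ) ^ (1 / 3 : ℝ) / ((m + 1 : ℕ) : ℝ) := by
        rw [hgeom]
        gcongr
        exact div_nonneg (by linarith) h1x.le
    _ = (1 - x / 2) / (1 - x) / ((m + 1 : ℕ) : ℝ) * (2 : ℝ) ^ (1 / 3 : ℝ) := by ring
    _ = 3 / 4 * (2 : ℝ) ^ (1 / 3 : ℝ) := by rw [hratio]

/-- **`J(s) ≤ 25/28` for every `s ≥ 7`** (a two-level substitute for "`J` is decreasing",
BCCGNSU 2017 after (4.10); `25/28 = 0.8928… < e^{-2δ} = 0.89291…`, while `J(7) = 0.8794…`):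
evaluate the infimum at `x = (25m-31)/(25m+18)`, `m = s - 1 ≥ 6`, where `x^m ≥ 1/8` (degree-7
Bonferroni), so `x^{-m/3} ≤ 2` and `(1 - x^s)/(s(1-x)) ≤ (1 - x/8)/(s(1-x)) = 25/56`.
[cite: BlasiakChurchCohnGrochowNaslundSawinUmans2017, (4.10)–(4.11)] -/
theorem bccgnsuJ_le_of_seven_le {s : ℕ} (hs : 7 ≤ s) : bccgnsuJ s ≤ 25 / 28 := by
  obtain ⟨m, rfl⟩ : ∃ m, s = m + 1 := ⟨s - 1, by omega⟩
  have hm6 : 6 ≤ m := by omega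
  have hmR : (6 : ℝ) ≤ m := by exact_mod_cast hm6
  set x : ℝ := 1 - 49 / (25 * m + 18) with hx
  have hden : (0 : ℝ) < 25 * m + 18 := by positivity
  have hx0 : 0 < x := by
    rw [hx, sub_pos, div_lt_one hden]; linarith
  have hx1 : x < 1 := by
    rw [hx, sub_lt_self_iff]; positivity
  have h1x : 0 < 1 - x := by linarith
  have hxm : (1 / 8 : ℝ) ≤ x ^ m := eighth_le_one_sub_div_pow m hm6
  have hJ := bccgnsuJ_le (s := m + 1) hx0 hx1
  have hcast : (((m + 1 : ℕ) : ℝ) - 1) = (m : ℝ) := by push_cast; ring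
  rw [hcast] at hJ
  have hgeom : (∑ i ∈ Finset.range (m + 1), x ^ i) = (1 - x ^ (m + 1)) / (1 - x) := by
    rw [eq_div_iff h1x.ne', geom_sum_mul_neg]
  have hpow : x ^ (-((m : ℝ) / 3)) ≤ 2 := by
    have h1 : x ^ (-((m : ℝ) / 3)) = (x ^ m) ^ (-(1 / 3 : ℝ)) := by
      rw [← Real.rpow_natCast_mul hx0.le]; congr 1; ring
    have h2 : (x ^ m) ^ (-(1 / 3 : ℝ)) ≤ (1 / 8 : ℝ) ^ (-(1 / 3 : ℝ)) :=
      Real.rpow_le_rpow_of_nonpos (by norm_num) hxm (by norm_num)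
    have h3 : (1 / 8 : ℝ) ^ (-(1 / 3 : ℝ)) = 2 := by
      rw [Real.rpow_neg (by norm_num), one_div (8 : ℝ), Real.inv_rpow (by norm_num), inv_inv,
        show (8 : ℝ) = 2 ^ (3 : ℝ) by norm_num, ← Real.rpow_mul (by norm_num)]
      norm_num
    rw [h1, ← h3]; exact h2
  have hsum : (1 - x ^ (m + 1)) / (1 - x) ≤ (1 - x / 8) / (1 - x) := by
    refine div_le_div_of_nonneg_right ?_ h1x.le
    have : x / 8 ≤ x ^ (m + 1) := by
      rw [pow_succ']
      have := mul_le_mul_of_nonneg_left hxm hx0.le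
      linarith
    linarith
  have hratio : (1 - x / 8) / (1 - x) / ((m + 1 : ℕ) : ℝ) = 25 / 56 := by
    rw [hx]; field_simp; push_cast; ring
  calc bccgnsuJ (m + 1)
      ≤ (∑ i ∈ Finset.range (m + 1), x ^ i) * x ^ (-((m : ℝ) / 3)) / ((m + 1 : ℕ) : ℝ) := hJ
    _ ≤ (1 - x / 8) / (1 - x) * 2 / ((m + 1 : ℕ) : ℝ) := by
        rw [hgeom]
        gcongr
        exact div_nonneg (by linarith) h1x.le
    _ = (1 - x / 8) / (1 - x) / ((m + 1 : ℕ) : ℝ) * 2 := by ring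
    _ = 25 / 28 := by rw [hratio]; norm_num

/-- `e^{-δ} = (3/4)·2^{1/3}` (`= J(2)`; BCCGNSU 2017, proof of Thm. A′: "`J(2) = e^{-δ}`").
[cite: BlasiakChurchCohnGrochowNaslundSawinUmans2017, Thm. A′ (proof)] -/
theorem exp_neg_bccgnsuDelta : Real.exp (-bccgnsuDelta) = 3 / 4 * (2 : ℝ) ^ (1 / 3 : ℝ) := by
  unfold bccgnsuDelta
  have h2 : (0 : ℝ) < (2 : ℝ) ^ (2 / 3 : ℝ) := Real.rpow_pos_of_pos (by norm_num) _
  rw [Real.exp_neg, Real.exp_log (by positivity)]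
  have hkey : (2 : ℝ) ^ (2 / 3 : ℝ) * (2 : ℝ) ^ (1 / 3 : ℝ) = 2 := by
    rw [← Real.rpow_add (by norm_num)]; norm_num
  refine inv_eq_of_mul_eq_one_right ?_
  calc 2 / 3 * (2 : ℝ) ^ (2 / 3 : ℝ) * (3 / 4 * (2 : ℝ) ^ (1 / 3 : ℝ))
      = 1 / 2 * ((2 : ℝ) ^ (2 / 3 : ℝ) * (2 : ℝ) ^ (1 / 3 : ℝ)) := by ring
    _ = 1 := by rw [hkey]; norm_num

/-- `J(s) ≤ e^{-δ}` for all `s ≥ 2` ("the worst case for this bound occurs when the prime power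
`q` is `2`", BCCGNSU 2017, proof of Thm. A′).
[cite: BlasiakChurchCohnGrochowNaslundSawinUmans2017, Thm. A′ (proof)] -/
theorem bccgnsuJ_le_exp_neg_delta {s : ℕ} (hs : 2 ≤ s) : bccgnsuJ s ≤ Real.exp (-bccgnsuDelta) := by
  rw [exp_neg_bccgnsuDelta]; exact bccgnsuJ_le_J_two hs

/-- `25/28 ≤ e^{-2δ} = (9/16)·2^{2/3}` (since `(100/63)³ < 4`), so `J(s) ≤ e^{-2δ}` for `s ≥ 7`.
[folklore] -/
theorem bccgnsuJ_le_exp_neg_two_delta {s : ℕ} (hs : 7 ≤ s) :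
    bccgnsuJ s ≤ Real.exp (-(2 * bccgnsuDelta)) := by
  refine (bccgnsuJ_le_of_seven_le hs).trans ?_
  have h : Real.exp (-(2 * bccgnsuDelta)) = (3 / 4 * (2 : ℝ) ^ (1 / 3 : ℝ)) ^ 2 := by
    rw [← exp_neg_bccgnsuDelta, ← Real.exp_nat_mul]; congr 1; ring
  rw [h]
  -- `25/28 ≤ (9/16) 2^{2/3}`, i.e. `100/63 ≤ 2^{2/3}`, from `(100/63)^3 ≤ 4 = (2^{2/3})^3`
  have h23 : ((2 : ℝ) ^ (1 / 3 : ℝ)) ^ 2 = (2 : ℝ) ^ (2 / 3 : ℝ) := by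
    rw [← Real.rpow_natCast, ← Real.rpow_mul (by norm_num)]; norm_num
  have hcube : ((2 : ℝ) ^ (2 / 3 : ℝ)) ^ (3 : ℕ) = 4 := by
    rw [← Real.rpow_natCast, ← Real.rpow_mul (by norm_num)]; norm_num
  have hle : (100 / 63 : ℝ) ≤ (2 : ℝ) ^ (2 / 3 : ℝ) := by
    refine le_of_pow_le_pow_left₀ (n := 3) (by norm_num) (Real.rpow_nonneg (by norm_num) _) ?_
    rw [hcube]; norm_num
  rw [mul_pow, h23]
  linarith

end JBounds

/-! ## The number of low-weight vectors and Theorem 4.14 -/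

section Thm414

open Literature.Combinatorics.Additive

/-- **The sharp count of low-weight vectors** (BCCGNSU 2017, Prop. 4.12 with `α = 1/3`, in the
form used in Prop. 4.13): `#{v ∈ {0,…,q-1}^n : 3Σv ≤ (q-1)n} ≤ (q J(q))^n`. Proof: the
generating-function bound of the tree (`card_lowWeight_mul_pow_le`, at `v = x^{1/3}`) gives
`# ≤ f(x)^n` for every `x ∈ (0,1)`, `f(x) = (Σ_{i<q} xⁱ) x^{-(q-1)/3}`, and `q J(q) = inf f`.
[cite: BlasiakChurchCohnGrochowNaslundSawinUmans2017, Prop. 4.12] -/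
theorem card_lowWeight_le_pow {q : ℕ} (hq : 1 ≤ q) (κ : Type*) [Fintype κ] [DecidableEq κ] :
    (Fintype.card (LowWeight q κ) : ℝ) ≤ ((q : ℝ) * bccgnsuJ q) ^ Fintype.card κ := by
  set f : ℝ → ℝ := fun x : ℝ =>
    (∑ i ∈ Finset.range q, x ^ i) * x ^ (-(((q : ℝ) - 1) / 3)) with hf
  have hf0 : ∀ x : ℝ, 0 < x → 0 ≤ f x := fun x hx =>
    mul_nonneg (Finset.sum_nonneg fun i _ => pow_nonneg hx.le i) (Real.rpow_nonneg hx.le _)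
  have hq1 : ((q - 1 : ℕ) : ℝ) = (q : ℝ) - 1 := by rw [Nat.cast_sub hq, Nat.cast_one]
  -- the bound at each `x ∈ (0,1)`
  have key : ∀ x : ℝ, 0 < x → x < 1 →
      (Fintype.card (LowWeight q κ) : ℝ) ≤ f x ^ Fintype.card κ := by
    intro x hx0 hx1
    set v : ℝ := x ^ (1 / 3 : ℝ) with hv
    have hv0 : 0 < v := Real.rpow_pos_of_pos hx0 _
    have hv1 : v ≤ 1 := Real.rpow_le_one hx0.le hx1.le (by norm_num)
    have h := card_lowWeight_mul_pow_le q κ v hv0.le hv1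
    have h3 : ∀ b : ℕ, v ^ (3 * b) = x ^ b := by
      intro b
      rw [hv, ← Real.rpow_natCast, ← Real.rpow_mul hx0.le, show (1 / 3 : ℝ) * ((3 * b : ℕ) : ℝ) = b by
        push_cast; ring, Real.rpow_natCast]
    simp_rw [h3] at h
    have hvpow : v ^ ((q - 1) * Fintype.card κ) = x ^ (((q : ℝ) - 1) / 3 * Fintype.card κ) := by
      rw [hv, ← Real.rpow_natCast, ← Real.rpow_mul hx0.le]
      congr 1
      push_cast [hq1]
      ring
    have hxpos : 0 < x ^ (((q : ℝ) - 1) / 3 * Fintype.card κ) := Real.rpow_pos_of_pos hx0 _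
    rw [hvpow, ← le_div_iff₀ hxpos] at h
    refine h.trans (le_of_eq ?_)
    rw [hf]
    simp only
    rw [mul_pow, div_eq_mul_inv, ← Real.rpow_neg hx0.le,
      show -(((q : ℝ) - 1) / 3 * Fintype.card κ) = (-(((q : ℝ) - 1) / 3)) * Fintype.card κ by ring,
      Real.rpow_mul_natCast hx0.le]
  -- pass to the infimum
  have hne : (f '' Set.Ioo (0 : ℝ) 1).Nonempty :=
    ⟨f (1 / 2), 1 / 2, ⟨by norm_num, by norm_num⟩, rfl⟩
  have hqJ : (q : ℝ) * bccgnsuJ q = sInf (f '' Set.Ioo (0 : ℝ) 1) := by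
    have hq0 : (q : ℝ) ≠ 0 := by exact_mod_cast (show q ≠ 0 by omega)
    unfold bccgnsuJ
    rw [← hf, mul_div_cancel₀ _ hq0]
  rw [hqJ]
  set L := sInf (f '' Set.Ioo (0 : ℝ) 1) with hL
  have hcont : Filter.Tendsto (fun t : ℝ => t ^ Fintype.card κ) (nhdsWithin L (Set.Ioi L))
      (nhds (L ^ Fintype.card κ)) :=
    ((continuous_pow (Fintype.card κ)).tendsto L).mono_left nhdsWithin_le_nhds
  refine ge_of_tendsto hcont ?_
  filter_upwards [self_mem_nhdsWithin] with t ht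
  obtain ⟨y, ⟨x, hx, rfl⟩, hyt⟩ := exists_lt_of_csInf_lt hne ht
  exact (key x hx.1 hx.2).trans (pow_le_pow_left₀ (hf0 x hx.1) hyt.le _)

/-- **BCCGNSU 2017, Thm. 4.14** (core form, arbitrary finite index type and finite complement):
if `H ≃ (ℤ/q)^κ × G` with `q = p^r` a prime power, every tricolored sum-free set in `H` has size at
most `3 |H| J(q)^{|κ|}` (tree's counting form `IsTricoloredSumFree.card_le_of_addEquiv` +
`card_lowWeight_le_pow`). [cite: BlasiakChurchCohnGrochowNaslundSawinUmans2017, Thm. 4.14] -/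
theorem card_le_of_addEquiv_J {p : ℕ} [Fact p.Prime] {q : ℕ} [NeZero q] (r : ℕ) (hq : q = p ^ r)
    {κ : Type*} [Fintype κ] [DecidableEq κ] {G : Type*} [AddCommGroup G] [Fintype G]
    {H : Type*} [AddCommGroup H] [Fintype H] (e : H ≃+ (κ → ZMod q) × G)
    {ι : Type*} [Fintype ι] {s t u : ι → H} (h : IsTricoloredSumFree s t u) :
    (Fintype.card ι : ℝ) ≤ 3 * Fintype.card H * bccgnsuJ q ^ Fintype.card κ := by
  classical
  have hq1 : 1 ≤ q := NeZero.one_le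
  have hb := h.card_le_of_addEquiv (p := p) r hq e
  have hLW := card_lowWeight_le_pow hq1 κ
  have hcardH : (Fintype.card H : ℝ) = (q : ℝ) ^ Fintype.card κ * Fintype.card G := by
    have := Fintype.card_congr e.toEquiv
    rw [Fintype.card_prod, Fintype.card_pi, Finset.prod_const, ZMod.card, Finset.card_univ] at this
    rw [this]; push_cast; ring
  have hJ0 : 0 ≤ bccgnsuJ q := bccgnsuJ_nonneg q
  calc (Fintype.card ι : ℝ)
      ≤ 3 * Fintype.card (LowWeight q κ) * Fintype.card G := by exact_mod_cast hb
    _ ≤ 3 * (((q : ℝ) * bccgnsuJ q) ^ Fintype.card κ) * Fintype.card G := by gcongr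
    _ = 3 * Fintype.card H * bccgnsuJ q ^ Fintype.card κ := by rw [hcardH, mul_pow]; ring

/-- **BCCGNSU 2017, Thm. 4.14 PROVED** in its explicit-constant form `BCCGNSU2017_thm414`:
`|M| ≤ 3 |H| J(q)ⁿ` for `H ≅ (ℤ/qℤ)ⁿ × G`, `q` a prime power.
[cite: BlasiakChurchCohnGrochowNaslundSawinUmans2017, Thm. 4.14] -/
theorem BCCGNSU2017_thm414_holds : BCCGNSU2017_thm414 := by
  intro q n hq G _ H _ _ hH ι _ s t u hM
  obtain ⟨e⟩ := hH
  classical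
  obtain ⟨p, k, hp, hk, hpk⟩ := (isPrimePow_nat_iff q).1 hq
  haveI : Fact p.Prime := ⟨hp⟩
  haveI : NeZero q := ⟨hq.ne_zero⟩
  haveI : Finite G := by
    refine Finite.of_injective (fun g : G => e.symm (0, g)) fun a b hab => ?_
    have := e.symm.injective hab
    exact (Prod.mk.inj this).2
  letI : Fintype G := Fintype.ofFinite G
  have h := card_le_of_addEquiv_J (p := p) k hpk.symm e hM
  rwa [Fintype.card_fin] at h

/-- **BCCGNSU 2017, Thm. A′ PROVED** in its explicit-constant form `BCCGNSU2017_thmA'`: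
`|M| ≤ 3 |H|^{1 - δ/log q}` for `H ≅ (ℤ/qℤ)ⁿ`, `δ = log((2/3)2^{2/3})` (Thm. 4.14 with trivial `G`,
`J(q) ≤ e^{-δ}`, and `qⁿ e^{-δ n} = |H|^{1-δ/log q}`).
[cite: BlasiakChurchCohnGrochowNaslundSawinUmans2017, Thm. A′] -/
theorem BCCGNSU2017_thmA'_holds : BCCGNSU2017_thmA' := by
  intro q n hq H _ _ hH ι _ s t u hM
  obtain ⟨e⟩ := hH
  have e' : H ≃+ (Fin n → ZMod q) × PUnit.{1} := e.trans AddEquiv.prodUnique.symm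
  have h414 := BCCGNSU2017_thm414_holds q n hq PUnit H ⟨e'⟩ ι s t u hM
  have hq1 : 1 < q := hq.one_lt
  haveI : NeZero q := ⟨by omega⟩
  have hcard : Fintype.card H = q ^ n := by
    rw [Fintype.card_congr e.toEquiv, Fintype.card_pi, Finset.prod_const, ZMod.card,
      Finset.card_univ, Fintype.card_fin]
  have hq0 : (0 : ℝ) < q := by exact_mod_cast (zero_lt_one.trans hq1)
  have hlog : Real.log q ≠ 0 := Real.log_ne_zero_of_pos_of_ne_one hq0 (by exact_mod_cast hq1.ne')
  have hJ : bccgnsuJ q ≤ Real.exp (-bccgnsuDelta) := bccgnsuJ_le_exp_neg_delta hq1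
  have hJn : bccgnsuJ q ^ n ≤ Real.exp (-(bccgnsuDelta * n)) := by
    calc bccgnsuJ q ^ n ≤ Real.exp (-bccgnsuDelta) ^ n := pow_le_pow_left₀ (bccgnsuJ_nonneg q) hJ n
      _ = Real.exp (-(bccgnsuDelta * n)) := by rw [← Real.exp_nat_mul]; congr 1; ring
  have eq1 : (((q ^ n : ℕ) : ℝ)) ^ (1 - bccgnsuDelta / Real.log q) =
      (q : ℝ) ^ n * Real.exp (-(bccgnsuDelta * n)) := by
    push_cast
    rw [← Real.rpow_natCast (q : ℝ) n, ← Real.rpow_mul hq0.le, mul_sub, mul_one, sub_eq_add_neg,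
      Real.rpow_add hq0]
    congr 1
    rw [Real.rpow_def_of_pos hq0]
    congr 1
    field_simp
  have hHR : (Fintype.card H : ℝ) = (q : ℝ) ^ n := by rw [hcard]; push_cast; ring
  calc (Fintype.card ι : ℝ) ≤ 3 * Fintype.card H * bccgnsuJ q ^ n := h414
    _ ≤ 3 * Fintype.card H * Real.exp (-(bccgnsuDelta * n)) := by gcongr
    _ = 3 * (Fintype.card H : ℝ) ^ (1 - bccgnsuDelta / Real.log q) := by
        rw [hcard, eq1]; push_cast; ring

end Thm414

/-! ## Products of distinct prime powers up to `m` (a Chebyshev-type bound) -/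

section PrimePowers

/-- Growth inequality, odd dyadic exponent `k = 2i+1`:
`28 + 2·2^{i+1}·(2i+2)(2i) ≤ 15·2^{2i+1}`. [folklore] -/
theorem primePowGrowth_odd (i : ℕ) :
    28 + 2 * 2 ^ (i + 1) * ((2 * i + 2) * (2 * i)) ≤ 15 * 2 ^ (2 * i + 1) := by
  induction i with
  | zero => norm_num
  | succ j ih =>
    rcases Nat.lt_or_ge j 2 with hj | hj
    · interval_cases j <;> norm_num
    · set a : ℕ := 2 ^ (j + 1) with ha
      set b : ℕ := 2 ^ (2 * j + 1) with hb
      have h2a : 2 ^ (j + 1 + 1) = 2 * a := by rw [ha, pow_succ]; ring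
      have h4b : 2 ^ (2 * (j + 1) + 1) = 4 * b := by
        rw [hb, show 2 * (j + 1) + 1 = (2 * j + 1) + 2 by ring, pow_add]; ring
      rw [h2a, h4b]
      have hj' : 2 * (j + 1) + 2 ≤ 2 * (2 * j) := by omega
      calc 28 + 2 * (2 * a) * ((2 * (j + 1) + 2) * (2 * (j + 1)))
          = 28 + 4 * a * (2 * j + 2) * (2 * (j + 1) + 2) := by ring
        _ ≤ 28 + 4 * a * (2 * j + 2) * (2 * (2 * j)) := by gcongr
        _ = 28 + 8 * (a * ((2 * j + 2) * (2 * j))) := by ring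
        _ ≤ 4 * (28 + 2 * a * ((2 * j + 2) * (2 * j))) := by linarith
        _ ≤ 4 * (15 * b) := Nat.mul_le_mul_left 4 ih
        _ = 15 * (4 * b) := by ring

/-- Growth inequality, even dyadic exponent `k = 2i+2`:
`28 + 2·(3·2^i)·(2i+3)(2i+1) ≤ 15·2^{2i+2}`. [folklore] -/
theorem primePowGrowth_even (i : ℕ) :
    28 + 2 * (3 * 2 ^ i) * ((2 * i + 3) * (2 * i + 1)) ≤ 15 * 2 ^ (2 * i + 2) := by
  induction i with
  | zero => norm_num
  | succ j ih =>
    rcases Nat.lt_or_ge j 2 with hj | hj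
    · interval_cases j <;> norm_num
    · set a : ℕ := 3 * 2 ^ j with ha
      set b : ℕ := 2 ^ (2 * j + 2) with hb
      have h2a : 3 * 2 ^ (j + 1) = 2 * a := by rw [ha, pow_succ]; ring
      have h4b : 2 ^ (2 * (j + 1) + 2) = 4 * b := by
        rw [hb, show 2 * (j + 1) + 2 = (2 * j + 2) + 2 by ring, pow_add]; ring
      rw [h2a, h4b]
      have hj' : 2 * (j + 1) + 3 ≤ 2 * (2 * j + 1) := by omega
      calc 28 + 2 * (2 * a) * ((2 * (j + 1) + 3) * (2 * (j + 1) + 1))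
          = 28 + 4 * a * (2 * j + 3) * (2 * (j + 1) + 3) := by ring
        _ ≤ 28 + 4 * a * (2 * j + 3) * (2 * (2 * j + 1)) := by gcongr
        _ = 28 + 8 * (a * ((2 * j + 3) * (2 * j + 1))) := by ring
        _ ≤ 4 * (28 + 2 * a * ((2 * j + 3) * (2 * j + 1))) := by linarith
        _ ≤ 4 * (15 * b) := Nat.mul_le_mul_left 4 ih
        _ = 15 * (4 * b) := by ring

/-- **The growth inequality**: for `m ≥ 2` and `2c ≤ ⌊√m⌋ + 1`,
`120 · 4^m · m^{c(⌊log₂ m⌋ - 1)} ≤ 54^m` (dyadic decomposition `2^k ≤ m < 2^{k+1}`, the two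
auxiliary inequalities, and `2^{23} ≤ 54^4`). [folklore] -/
theorem primePowGrowth_le (m : ℕ) (hm : 2 ≤ m) {c : ℕ} (hc : 2 * c ≤ Nat.sqrt m + 1) :
    120 * 4 ^ m * m ^ (c * (Nat.log 2 m - 1)) ≤ 54 ^ m := by
  set k := Nat.log 2 m with hk
  set r := Nat.sqrt m with hr
  have hk1 : 1 ≤ k := Nat.le_log_of_pow_le one_lt_two (by simpa using hm)
  have hmk : m < 2 ^ (k + 1) := Nat.lt_pow_succ_log_self one_lt_two m
  have hkm : 2 ^ k ≤ m := Nat.pow_log_le_self 2 (by omega)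
  have hrm : r * r ≤ m := Nat.sqrt_le m
  obtain ⟨k', hk'⟩ : ∃ k', k = k' + 1 := ⟨k - 1, by omega⟩
  have hsub : k - 1 = k' := by omega
  rw [hsub]
  -- the key numerical inequality `28 + 4(k+1) c k' ≤ 15 · 2^k`
  have hmain : 28 + 4 * (k + 1) * (c * k') ≤ 15 * 2 ^ k := by
    obtain ⟨i, hi | hi⟩ := Nat.even_or_odd' k'
    · -- `k = 2i + 1`, `r + 1 ≤ 2^{i+1}`
      have hr1 : r < 2 ^ (i + 1) := by
        rw [hr, Nat.sqrt_lt]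
        calc m < 2 ^ (k + 1) := hmk
          _ = 2 ^ (i + 1) * 2 ^ (i + 1) := by rw [hk', hi, ← pow_add]; ring_nf
      calc 28 + 4 * (k + 1) * (c * k') = 28 + (2 * c) * (2 * ((k + 1) * k')) := by ring
        _ ≤ 28 + (r + 1) * (2 * ((k + 1) * k')) := by gcongr
        _ ≤ 28 + 2 ^ (i + 1) * (2 * ((k + 1) * k')) := by gcongr; omega
        _ = 28 + 2 * 2 ^ (i + 1) * ((2 * i + 2) * (2 * i)) := by rw [hk', hi]; ring
        _ ≤ 15 * 2 ^ (2 * i + 1) := primePowGrowth_odd i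
        _ = 15 * 2 ^ k := by rw [hk', hi]
    · -- `k = 2i + 2`, `r + 1 ≤ 3 · 2^i`
      have hr1 : r < 3 * 2 ^ i := by
        rw [hr, Nat.sqrt_lt]
        calc m < 2 ^ (k + 1) := hmk
          _ = 8 * (2 ^ i * 2 ^ i) := by
              rw [hk', hi, show 2 * i + 1 + 1 + 1 = (i + i) + 3 by ring, pow_add, pow_add]; ring
          _ ≤ 3 * 2 ^ i * (3 * 2 ^ i) := by nlinarith [pow_pos (two_pos : (0 : ℕ) < 2) i]
      calc 28 + 4 * (k + 1) * (c * k') = 28 + (2 * c) * (2 * ((k + 1) * k')) := by ring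
        _ ≤ 28 + (r + 1) * (2 * ((k + 1) * k')) := by gcongr
        _ ≤ 28 + 3 * 2 ^ i * (2 * ((k + 1) * k')) := by gcongr; omega
        _ = 28 + 2 * (3 * 2 ^ i) * ((2 * i + 3) * (2 * i + 1)) := by rw [hk', hi]; ring
        _ ≤ 15 * 2 ^ (2 * i + 2) := primePowGrowth_even i
        _ = 15 * 2 ^ k := by rw [hk', hi]
  -- `120 · 4^m · m^{c k'} ≤ 2^a` with `4a ≤ 23 m`
  have h2a : 120 * 4 ^ m * m ^ (c * k') ≤ 2 ^ (7 + 2 * m + (k + 1) * (c * k')) := by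
    calc 120 * 4 ^ m * m ^ (c * k') ≤ 2 ^ 7 * 2 ^ (2 * m) * (2 ^ (k + 1)) ^ (c * k') := by
          refine Nat.mul_le_mul (Nat.mul_le_mul (by norm_num) (le_of_eq ?_))
            (Nat.pow_le_pow_left hmk.le _)
          rw [pow_mul]; norm_num
      _ = 2 ^ (7 + 2 * m + (k + 1) * (c * k')) := by rw [← pow_mul, ← pow_add, ← pow_add]
  have h4a : 4 * (7 + 2 * m + (k + 1) * (c * k')) ≤ 23 * m := by linarith
  have hfin : 2 ^ (7 + 2 * m + (k + 1) * (c * k')) ≤ 54 ^ m := by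
    set a := 7 + 2 * m + (k + 1) * (c * k') with ha
    have h4 : (2 ^ a) ^ 4 ≤ (54 ^ m) ^ 4 := by
      calc (2 ^ a) ^ 4 = 2 ^ (4 * a) := by rw [← pow_mul, mul_comm]
        _ ≤ 2 ^ (23 * m) := Nat.pow_le_pow_right two_pos h4a
        _ = (2 ^ 23) ^ m := by rw [pow_mul]
        _ ≤ (54 ^ 4) ^ m := Nat.pow_le_pow_left (by norm_num) m
        _ = (54 ^ m) ^ 4 := by rw [← pow_mul, ← pow_mul, mul_comm]
    exact (Nat.pow_le_pow_iff_left (by norm_num : (4 : ℕ) ≠ 0)).1 h4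
  exact h2a.trans hfin

/-- The primes `p ≤ r` are at most `(r+1)/2` in number (`p ↦ (p+1)/2` is injective on primes and
lands in `[1, (r+1)/2]`). [folklore] -/
theorem card_primes_le_half_succ (r : ℕ) : ((range (r + 1)).filter Nat.Prime).card ≤ (r + 1) / 2 := by
  have hmaps : Set.MapsTo (fun p => (p + 1) / 2) ((range (r + 1)).filter Nat.Prime : Finset ℕ)
      (Icc 1 ((r + 1) / 2) : Finset ℕ) := by
    intro p hp
    simp only [coe_filter, mem_range, Set.mem_setOf_eq] at hp
    have h2 := hp.2.two_le
    simp only [coe_Icc, Set.mem_Icc]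
    omega
  have hinj : Set.InjOn (fun p => (p + 1) / 2) ((range (r + 1)).filter Nat.Prime : Finset ℕ) := by
    intro p hp p' hp' h
    simp only [coe_filter, mem_range, Set.mem_setOf_eq] at hp hp'
    have h2 := hp.2.two_le
    have h2' := hp'.2.two_le
    simp only at h
    rcases hp.2.eq_two_or_odd with rfl | hpo <;> rcases hp'.2.eq_two_or_odd with rfl | hpo' <;> omega
  calc ((range (r + 1)).filter Nat.Prime).card ≤ (Icc 1 ((r + 1) / 2)).card :=
        Finset.card_le_card_of_injOn _ hmaps hinj
    _ = (r + 1) / 2 := by simp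

/-- **Distinct prime powers up to `m` have a small product**: if `S` is a finite set of prime
powers, all at most `m` (`m ≥ 2`), then `120 · ∏_{v ∈ S} v ≤ 54^m` (`< e^{4m}`). Proof: the
primes in `S` contribute at most `primorial(m) ≤ 4^m` (Chebyshev, Mathlib's
`primorial_le_four_pow`); the proper prime powers `p^j ∈ S` (`j ≥ 2`) are each `≤ m`, and there
are at most `#{p prime ≤ √m} · (⌊log₂ m⌋ - 1) ≤ ((⌊√m⌋+1)/2)(⌊log₂ m⌋ - 1)` of them; conclude with
`primePowGrowth_le`. (This crude substitute for the prime-number-theorem count of prime powers in the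
printed proof of BCCGNSU 2017, Thm. A, is what the two-level bound on `J` below needs.)
[folklore] -/
theorem prod_primePow_le_pow (m : ℕ) (hm : 2 ≤ m) (S : Finset ℕ)
    (hS : ∀ v ∈ S, IsPrimePow v ∧ v ≤ m) : 120 * ∏ v ∈ S, v ≤ 54 ^ m := by
  set S₁ := S.filter Nat.Prime with hS₁
  set S₂ := S.filter (fun v => ¬ v.Prime) with hS₂
  have hsplit : ∏ v ∈ S, v = (∏ v ∈ S₁, v) * ∏ v ∈ S₂, v :=
    (Finset.prod_filter_mul_prod_filter_not S Nat.Prime (fun v => v)).symm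
  -- the primes
  have h1 : ∏ v ∈ S₁, v ≤ 4 ^ m := by
    have hsub : S₁ ⊆ (range (m + 1)).filter Nat.Prime := by
      intro v hv
      obtain ⟨hvS, hvp⟩ := mem_filter.1 hv
      exact mem_filter.2 ⟨mem_range.2 (Nat.lt_succ_of_le (hS v hvS).2), hvp⟩
    calc ∏ v ∈ S₁, v ≤ ∏ v ∈ (range (m + 1)).filter Nat.Prime, v :=
          Finset.prod_le_prod_of_subset_of_one_le' hsub fun p hp _ => (mem_filter.1 hp).2.one_lt.le
      _ ≤ 4 ^ m := primorial_le_four_pow m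
  -- the proper prime powers
  set r := Nat.sqrt m with hr
  set k := Nat.log 2 m with hk
  set P := (range (r + 1)).filter Nat.Prime with hP
  have h2sub : S₂ ⊆ (P ×ˢ Icc 2 k).image (fun pj : ℕ × ℕ => pj.1 ^ pj.2) := by
    intro v hv
    obtain ⟨hvS, hvnp⟩ := mem_filter.1 hv
    obtain ⟨hvpp, hvm⟩ := hS v hvS
    obtain ⟨p, j, hp, hj, rfl⟩ := (isPrimePow_nat_iff _).1 hvpp
    have hj2 : 2 ≤ j := by
      by_contra hj2
      have hj1 : j = 1 := by omega
      rw [hj1, pow_one] at hvnp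
      exact hvnp hp
    refine mem_image.2 ⟨(p, j), mem_product.2 ⟨?_, ?_⟩, rfl⟩
    · have hpp : p * p ≤ m :=
        calc p * p = p ^ 2 := (sq p).symm
          _ ≤ p ^ j := Nat.pow_le_pow_right hp.pos hj2
          _ ≤ m := hvm
      exact mem_filter.2 ⟨mem_range.2 (Nat.lt_succ_of_le (Nat.le_sqrt.2 hpp)), hp⟩
    · have h2j : 2 ^ j ≤ m := (Nat.pow_le_pow_left hp.two_le j).trans hvm
      exact mem_Icc.2 ⟨hj2, Nat.le_log_of_pow_le one_lt_two h2j⟩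
  have h2card : S₂.card ≤ P.card * (k - 1) := by
    calc S₂.card ≤ ((P ×ˢ Icc 2 k).image (fun pj : ℕ × ℕ => pj.1 ^ pj.2)).card := card_le_card h2sub
      _ ≤ (P ×ˢ Icc 2 k).card := card_image_le
      _ = P.card * (k - 1) := by rw [card_product, Nat.card_Icc]; rfl
  have h2 : ∏ v ∈ S₂, v ≤ m ^ (P.card * (k - 1)) := by
    calc ∏ v ∈ S₂, v ≤ ∏ _v ∈ S₂, m := Finset.prod_le_prod' fun v hv => (hS v (mem_filter.1 hv).1).2
      _ = m ^ S₂.card := prod_const m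
      _ ≤ m ^ (P.card * (k - 1)) := Nat.pow_le_pow_right (by omega) h2card
  have hPc : 2 * P.card ≤ r + 1 := by
    have hP2 : P.card ≤ (r + 1) / 2 := card_primes_le_half_succ r
    omega
  calc 120 * ∏ v ∈ S, v = 120 * ((∏ v ∈ S₁, v) * ∏ v ∈ S₂, v) := by rw [hsplit]
    _ ≤ 120 * (4 ^ m * m ^ (P.card * (k - 1))) := by gcongr
    _ = 120 * 4 ^ m * m ^ (P.card * (k - 1)) := by ring
    _ ≤ 54 ^ m := primePowGrowth_le m hm hPc

/-- `54 < e^4`, hence `log 54 < 4`. [folklore] -/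
theorem log_54_lt_four : Real.log 54 < 4 := by
  rw [Real.log_lt_iff_lt_exp (by norm_num)]
  have h := Real.exp_one_gt_d9
  have h4 : Real.exp 4 = Real.exp 1 ^ 4 := by rw [← Real.exp_nat_mul]; norm_num
  rw [h4]
  have : (2.7182818283 : ℝ) ^ 4 ≤ Real.exp 1 ^ 4 := by gcongr
  linarith [show (54 : ℝ) < (2.7182818283 : ℝ) ^ 4 by norm_num]

/-- `6` is not a prime power. [folklore] -/
theorem not_isPrimePow_six : ¬ IsPrimePow (6 : ℕ) := by
  rw [isPrimePow_nat_iff_bounded]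
  decide

end PrimePowers

/-! ## Theorem A -/

section TheoremA

open Literature.Combinatorics.Additive

/-- If a finite abelian group `H` is generated by elements of order at most `m`, then every
cyclic factor `ℤ/p^e` (`e ≥ 1`) of a product decomposition `H ≃ Π i, ℤ/Qᵢ` has `p^e ≤ m`
(project to the factor: the generators land in the proper subgroup killed by `p^{e-1}` as soon
as `p^e > m`). This is the reduction "by the Chinese remainder theorem, `H ≅ Πᵢ (ℤ/qᵢℤ)^{nᵢ}`
with `q₁,…,q_r` the prime powers `≤ m`" of BCCGNSU 2017, proof of Thm. A.
[cite: BlasiakChurchCohnGrochowNaslundSawinUmans2017, Thm. A (proof)] -/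
theorem factor_le_of_closure_eq_top {H : Type*} [AddCommGroup H] [Finite H] {m : ℕ}
    (hgen : AddSubgroup.closure {h : H | addOrderOf h ≤ m} = ⊤)
    {κ : Type*} {Q : κ → ℕ} [∀ i, NeZero (Q i)] (g : H ≃+ (Π i, ZMod (Q i)))
    (i : κ) {p e : ℕ} (hp : p.Prime) (he : 1 ≤ e) (hQ : Q i = p ^ e) : Q i ≤ m := by
  classical
  by_contra hlt
  push Not at hlt
  let φ : H →+ ZMod (Q i) := (Pi.evalAddMonoidHom (fun j => ZMod (Q j)) i).comp g.toAddMonoidHom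
  have hφ : ∀ h : H, φ h = g h i := fun h => rfl
  have hall : ∀ h : H, (p ^ (e - 1)) • φ h = 0 := by
    intro h
    have hmem : h ∈ AddSubgroup.closure {h : H | addOrderOf h ≤ m} := by
      rw [hgen]; exact AddSubgroup.mem_top h
    refine AddSubgroup.closure_induction (p := fun x _ => (p ^ (e - 1)) • φ x = 0)
      ?_ ?_ ?_ ?_ hmem
    · intro x hx
      have hx' : addOrderOf x ≤ m := hx
      have hdvd : addOrderOf (φ x) ∣ p ^ e := by
        rw [← hQ]
        have h1 : addOrderOf (φ x) ∣ Fintype.card (ZMod (Q i)) := addOrderOf_dvd_card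
        rwa [ZMod.card] at h1
      obtain ⟨j, hj, hje⟩ := (Nat.dvd_prime_pow hp).1 hdvd
      have hle : addOrderOf (φ x) ≤ m :=
        (Nat.le_of_dvd (addOrderOf_pos x) (addOrderOf_map_dvd φ x)).trans hx'
      have hjlt : j < e := by
        by_contra hje'
        have h1 : p ^ e ≤ p ^ j := Nat.pow_le_pow_right hp.pos (by omega)
        rw [← hje] at h1
        omega
      rw [← addOrderOf_dvd_iff_nsmul_eq_zero, hje]
      exact pow_dvd_pow p (by omega)
    · simp
    · intro x y _ _ hx hy
      rw [map_add, smul_add, hx, hy, add_zero]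
    · intro x _ hx
      rw [map_neg, smul_neg, hx, neg_zero]
  have h1 := hall (g.symm (Pi.single i 1))
  rw [hφ, AddEquiv.apply_symm_apply, Pi.single_eq_same, nsmul_eq_mul, mul_one] at h1
  have hdvd : Q i ∣ p ^ (e - 1) := (ZMod.natCast_eq_zero_iff _ _).1 (by exact_mod_cast h1)
  rw [hQ] at hdvd
  have h2 := Nat.le_of_dvd (pow_pos hp.pos _) hdvd
  have hlt' : p ^ (e - 1) < p ^ e := Nat.pow_lt_pow_right hp.one_lt (by omega)
  omega

/-- **BCCGNSU 2017, Thm. A PROVED** in its explicit-constant form `BCCGNSU2017_thmA`: if the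
finite abelian group `H` is generated by elements of order at most `m`, every tricolored sum-free
set in `H` has size at most `3 |H|^{1 - ε/m}`, `ε = ½ log((2/3)2^{2/3})`.

Proof (the printed one, §4.4, with the prime-number-theorem count of prime powers replaced by
a two-level bound on `J`): write `H ≅ Π_v (ℤ/v)^{n_v}` over the distinct prime powers `v ≤ m`
(`factor_le_of_closure_eq_top`); put `w_v = n_v` for `v ≤ 5` and `w_v = 2 n_v` for `v ≥ 7`, and
let `v₀` maximise `w`, `μ = w_{v₀}`. By Thm. 4.14, `|M| ≤ 3|H| J(v₀)^{n_{v₀}} ≤ 3|H| e^{-δ μ}`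
(`J ≤ e^{-δ}` always, `J ≤ 25/28 ≤ e^{-2δ}` from `7` on). On the other hand
`|H|² = Π_v v^{2 n_v} ≤ (Π_{v ≤ 5} v² · Π_{v ≥ 7} v)^μ ≤ (120 Π_v v)^μ ≤ 54^{m μ} < e^{4 m μ}`
(`prod_primePow_le_pow`), so `μ ≥ log|H|/(2m)` and `|M| ≤ 3|H|^{1 - δ/(2m)}`.
[cite: BlasiakChurchCohnGrochowNaslundSawinUmans2017, Thm. A] -/
theorem BCCGNSU2017_thmA_holds : BCCGNSU2017_thmA := by
  intro H _ _ m hgen ι _ s t u hM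
  classical
  -- the trivial group
  by_cases hH : Fintype.card H ≤ 1
  · haveI : Subsingleton H := Fintype.card_le_one_iff_subsingleton.1 hH
    have h1 : Fintype.card H = 1 := le_antisymm hH Fintype.card_pos
    have h2 : (Fintype.card ι : ℝ) ≤ 1 := by exact_mod_cast hM.card_le_one_of_subsingleton
    rw [h1, Nat.cast_one, Real.one_rpow]
    linarith
  push Not at hH
  -- decomposition into cyclic factors of prime-power order
  obtain ⟨κ, _, pr, hpr, ex, ⟨f⟩⟩ := AddCommGroup.equiv_directSum_zmod_of_finite H
  set Q : κ → ℕ := fun i => pr i ^ ex i with hQ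
  have hQpos : ∀ i, 0 < Q i := fun i => pow_pos (hpr i).pos _
  haveI : ∀ i, NeZero (Q i) := fun i => ⟨(hQpos i).ne'⟩
  let g : H ≃+ (Π i, ZMod (Q i)) := f.trans (DirectSum.addEquivProd _)
  have hcardQ : Fintype.card H = ∏ i, Q i := by
    rw [Fintype.card_congr g.toEquiv, Fintype.card_pi]
    simp only [ZMod.card]
  have hQle : ∀ i, 1 < Q i → IsPrimePow (Q i) ∧ Q i ≤ m := by
    intro i hi
    have hex : ex i ≠ 0 := by
      intro h0
      simp only [hQ, h0, pow_zero, lt_self_iff_false] at hi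
    exact ⟨(hpr i).isPrimePow.pow hex,
      factor_le_of_closure_eq_top hgen g i (hpr i) (Nat.one_le_iff_ne_zero.2 hex) rfl⟩
  -- values and multiplicities
  set mult : ℕ → ℕ := fun v => (univ.filter fun i => Q i = v).card with hmult
  set vals : Finset ℕ := (univ.image Q).filter (fun v => 1 < v) with hvals
  have hmem_vals : ∀ v, v ∈ vals ↔ (∃ i, Q i = v) ∧ 1 < v := by
    intro v; simp [hvals]
  have hvals_pp : ∀ v ∈ vals, IsPrimePow v ∧ v ≤ m := by
    intro v hv
    obtain ⟨⟨i, rfl⟩, h1⟩ := (hmem_vals v).1 hv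
    exact hQle i h1
  have hcardH : Fintype.card H = ∏ v ∈ vals, v ^ mult v := by
    rw [hcardQ, hvals, Finset.prod_filter_of_ne]
    · exact Finset.prod_comp (fun v : ℕ => v) Q
    · intro v _ hne
      by_contra hv
      have hv1 : v = 0 ∨ v = 1 := by omega
      rcases hv1 with rfl | rfl
      · have h0 : mult 0 = 0 := by
          simp only [hmult, Finset.card_eq_zero, Finset.filter_eq_empty_iff]
          intro i _ hi
          exact absurd hi (hQpos i).ne'
        rw [h0, pow_zero] at hne
        exact hne rfl
      · rw [one_pow] at hne
        exact hne rfl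
  have hne : vals.Nonempty := by
    by_contra hv
    rw [Finset.not_nonempty_iff_eq_empty] at hv
    rw [hcardH, hv, Finset.prod_empty] at hH
    exact lt_irrefl _ hH
  obtain ⟨v₁, hv₁⟩ := hne
  have hm2 : 2 ≤ m := (hvals_pp v₁ hv₁).1.two_le.trans (hvals_pp v₁ hv₁).2
  -- weights and the maximiser
  set w : ℕ → ℕ := fun v => if v < 7 then mult v else 2 * mult v with hw
  obtain ⟨v₀, hv₀, hmax⟩ := vals.exists_max_image w ⟨v₁, hv₁⟩
  obtain ⟨hv₀pp, hv₀m⟩ := hvals_pp v₀ hv₀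
  have hv₀2 : 2 ≤ v₀ := hv₀pp.two_le
  set μ : ℕ := w v₀ with hμ
  -- split off the homocyclic factor `(ℤ/v₀)^{mult v₀}`
  set Pv : κ → Prop := fun i => Q i = v₀ with hPv
  let e₁ : (Π i, ZMod (Q i)) ≃+
      (Π i : {i // Pv i}, ZMod (Q i.1)) × (Π i : {i // ¬ Pv i}, ZMod (Q i.1)) :=
    (RingEquiv.piEquivPiSubtypeProd Pv (fun i => ZMod (Q i))).toAddEquiv
  let e₂ : (Π i : {i // Pv i}, ZMod (Q i.1)) ≃+ ({i // Pv i} → ZMod v₀) :=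
    AddEquiv.piCongrRight fun i => (ZMod.ringEquivCongr i.2).toAddEquiv
  let e : H ≃+ ({i // Pv i} → ZMod v₀) × (Π i : {i // ¬ Pv i}, ZMod (Q i.1)) :=
    g.trans (e₁.trans (AddEquiv.prodCongr e₂ (AddEquiv.refl _)))
  have hcardκ : Fintype.card {i // Pv i} = mult v₀ := by
    rw [Fintype.card_subtype]
  -- Theorem 4.14 at `v₀`
  obtain ⟨p, k, hp, hk, hpk⟩ := (isPrimePow_nat_iff v₀).1 hv₀pp
  haveI : Fact p.Prime := ⟨hp⟩
  haveI : NeZero v₀ := ⟨by omega⟩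
  have h414 := card_le_of_addEquiv_J (p := p) k hpk.symm e hM
  rw [hcardκ] at h414
  -- the two-level bound on `J`
  have hJμ : bccgnsuJ v₀ ^ mult v₀ ≤ Real.exp (-(bccgnsuDelta * μ)) := by
    by_cases h7 : v₀ < 7
    · have hμ' : μ = mult v₀ := by simp [hμ, hw, h7]
      calc bccgnsuJ v₀ ^ mult v₀ ≤ Real.exp (-bccgnsuDelta) ^ mult v₀ :=
            pow_le_pow_left₀ (bccgnsuJ_nonneg _) (bccgnsuJ_le_exp_neg_delta hv₀2) _
        _ = Real.exp (-(bccgnsuDelta * μ)) := by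
            rw [← Real.exp_nat_mul, hμ']; congr 1; ring
    · have hμ' : μ = 2 * mult v₀ := by simp [hμ, hw, h7]
      have h7' : 7 ≤ v₀ := by omega
      calc bccgnsuJ v₀ ^ mult v₀ ≤ Real.exp (-(2 * bccgnsuDelta)) ^ mult v₀ :=
            pow_le_pow_left₀ (bccgnsuJ_nonneg _) (bccgnsuJ_le_exp_neg_two_delta h7') _
        _ = Real.exp (-(bccgnsuDelta * μ)) := by
            rw [← Real.exp_nat_mul, hμ']; congr 1; push_cast; ring
  -- the number-theoretic bound `|H|² ≤ 54^{m μ}`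
  have hNT : Fintype.card H ^ 2 ≤ 54 ^ (m * μ) := by
    have hpt : ∀ v ∈ vals, (v ^ mult v) ^ 2 ≤ (if v < 7 then v ^ 2 else v) ^ μ := by
      intro v hv
      have hv1 : 1 ≤ v := ((hmem_vals v).1 hv).2.le
      have hwv : w v ≤ μ := hmax v hv
      by_cases h7 : v < 7
      · simp only [hw, h7, if_true] at hwv ⊢
        calc (v ^ mult v) ^ 2 = (v ^ 2) ^ mult v := by ring
          _ ≤ (v ^ 2) ^ μ := Nat.pow_le_pow_right (by positivity) hwv
      · simp only [hw, h7, if_false] at hwv ⊢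
        calc (v ^ mult v) ^ 2 = v ^ (2 * mult v) := by ring
          _ ≤ v ^ μ := Nat.pow_le_pow_right hv1 hwv
    have hsmall : ∏ v ∈ vals.filter (· < 7), v ≤ 120 := by
      have hsub : vals.filter (· < 7) ⊆ ({2, 3, 4, 5} : Finset ℕ) := by
        intro v hv
        obtain ⟨hv, h7⟩ := mem_filter.1 hv
        have hpp := (hvals_pp v hv).1
        have h2 := hpp.two_le
        have h6 : v ≠ 6 := fun h => not_isPrimePow_six (h ▸ hpp)
        simp only [Finset.mem_insert, Finset.mem_singleton]
        omega
      calc ∏ v ∈ vals.filter (· < 7), v ≤ ∏ v ∈ ({2, 3, 4, 5} : Finset ℕ), v :=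
            Finset.prod_le_prod_of_subset_of_one_le' hsub fun v hv _ => by
              simp only [Finset.mem_insert, Finset.mem_singleton] at hv; omega
        _ = 120 := by rfl
    calc Fintype.card H ^ 2 = ∏ v ∈ vals, (v ^ mult v) ^ 2 := by rw [hcardH, Finset.prod_pow]
      _ ≤ ∏ v ∈ vals, (if v < 7 then v ^ 2 else v) ^ μ := Finset.prod_le_prod' hpt
      _ = (∏ v ∈ vals, (if v < 7 then v ^ 2 else v)) ^ μ := Finset.prod_pow _ _ _
      _ = ((∏ v ∈ vals.filter (· < 7), v ^ 2) * ∏ v ∈ vals.filter (fun v => ¬ v < 7), v) ^ μ := by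
          rw [Finset.prod_ite]
      _ = ((∏ v ∈ vals.filter (· < 7), v) * ∏ v ∈ vals, v) ^ μ := by
          congr 1
          rw [Finset.prod_pow, sq, mul_assoc, Finset.prod_filter_mul_prod_filter_not]
      _ ≤ (120 * ∏ v ∈ vals, v) ^ μ := by gcongr
      _ ≤ (54 ^ m) ^ μ := Nat.pow_le_pow_left (prod_primePow_le_pow m hm2 vals hvals_pp) μ
      _ = 54 ^ (m * μ) := (pow_mul 54 m μ).symm
  -- logarithms: `log |H| ≤ 2 m μ`
  have hHpos : (0 : ℝ) < Fintype.card H := by exact_mod_cast Fintype.card_pos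
  have hmpos : (0 : ℝ) < m := by exact_mod_cast (show 0 < m by omega)
  have hlog : Real.log (Fintype.card H) ≤ 2 * m * μ := by
    have h1 : ((Fintype.card H : ℝ)) ^ 2 ≤ (54 : ℝ) ^ (m * μ) := by exact_mod_cast hNT
    have h2 := Real.log_le_log (by positivity) h1
    rw [Real.log_pow, Real.log_pow] at h2
    have h3 : ((m * μ : ℕ) : ℝ) * Real.log 54 ≤ ((m * μ : ℕ) : ℝ) * 4 :=
      mul_le_mul_of_nonneg_left log_54_lt_four.le (Nat.cast_nonneg _)
    push_cast at h2 h3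
    linarith
  have hexp : Real.exp (-(bccgnsuDelta * μ)) ≤ (Fintype.card H : ℝ) ^ (-(bccgnsuEpsilon / m)) := by
    rw [Real.rpow_def_of_pos hHpos, Real.exp_le_exp]
    unfold bccgnsuEpsilon
    have hδ := bccgnsuDelta_pos
    have hq : Real.log (Fintype.card H) / (2 * m) ≤ μ := by
      rw [div_le_iff₀ (by positivity)]; linarith
    have key : Real.log (Fintype.card H) * (bccgnsuDelta / 2 / m) ≤ bccgnsuDelta * μ := by
      calc Real.log (Fintype.card H) * (bccgnsuDelta / 2 / m)
          = bccgnsuDelta * (Real.log (Fintype.card H) / (2 * m)) := by ring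
        _ ≤ bccgnsuDelta * μ := mul_le_mul_of_nonneg_left hq hδ.le
    linarith
  calc (Fintype.card ι : ℝ) ≤ 3 * Fintype.card H * bccgnsuJ v₀ ^ mult v₀ := h414
    _ ≤ 3 * Fintype.card H * Real.exp (-(bccgnsuDelta * μ)) := by gcongr
    _ ≤ 3 * Fintype.card H * (Fintype.card H : ℝ) ^ (-(bccgnsuEpsilon / m)) := by gcongr
    _ = 3 * (Fintype.card H : ℝ) ^ (1 - bccgnsuEpsilon / m) := by
        rw [sub_eq_add_neg, Real.rpow_add hHpos, Real.rpow_one]; ring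

end TheoremA

/-! ## The catalogue entry -/

section Catalogue

/-- **The tricolored sum-free barrier holds**: all four conjuncts of the catalogue entry
`TricoloredSumFreeBarrier` — Thm. A (`BCCGNSU2017_thmA`), Thm. A′ (`BCCGNSU2017_thmA'`),
Thm. 4.14 (`BCCGNSU2017_thm414`) with their printed constants, and Thm. B (the tree's
`BlasiakChurchCohnGrochowNaslundSawinUmans2017_B`, discharged in
`GroupTheoreticMatMulThmBProofs.lean`) — are theorems.
[cite: BlasiakChurchCohnGrochowNaslundSawinUmans2017, Thm. A, Thm. A′, Thm. 4.14, Thm. B] -/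
theorem TricoloredSumFreeBarrier_holds : TricoloredSumFreeBarrier :=
  ⟨BCCGNSU2017_thmA_holds, BCCGNSU2017_thmA'_holds, BCCGNSU2017_thm414_holds,
    Literature.Computability.AlgebraicComplexity.BlasiakChurchCohnGrochowNaslundSawinUmans2017_B_holds⟩

end Catalogue

end Literature.Barriers.MatrixMultiplication
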